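import Literature.MathematicalPhysics.QuantumFieldTheory.Balaban1983to89.B7Prop1Local

/-!
# `Balaban1983to89.B14Claim246` — the claim of p. 246 of CMP 119: "If a plaquette `p′` is contained in
# `(P₀ᶜ)^{(1)}`, then Proposition 1 [12] implies that the new field `V` satisfies the bound `|V(∂p′) − 1| < 2L²ε₀`",
# TYPED in printed form and PROVED for the concrete block average (42) of [12] on `ℤ^d` from the tree's kernel proof
# of Proposition 1 of [12] with LOCAL hypothesis (`B7Prop1Local.prop1_local`)

statement-level skeleton of published theorems with citation tags; proofs where landed; nothing here is a claim
about the Yang–Mills mass gap.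

CITATION HEADER (lean-in-tree rule).  Source: T. Bałaban, *Convergent renormalization expansions for lattice gauge
theories*, Commun. Math. Phys. **119**, 243–285 (1988), doi:10.1007/bf01217741 [Balaban1988Convergent] (cell paper
B14; held `paper:balaban1988-cmp119-convergent-renormalization`, journal page = PDF page + 242; the sentence below was
read on the x2 render of PDF p. 4 = p. 246).  "[12]" = entry [12] of the reference list of [I] = CMP 109, i.e.
T. Bałaban, *Averaging operations for lattice gauge theories*, Commun. Math. Phys. **98**, 17–51 (1985)
[Balaban1985Averaging] (cell paper B7), Proposition 1 (51) p. 26: typed `B7.Prop1Printed`, PROVED for the concrete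
average (42) on `ℤ^d` in `B7Prop1Explicit.prop1_explicit` (global hypothesis) and `B7Prop1Local.prop1_local`
(hypothesis (44) only for `p ⊂ Δ(p′)`, as printed).  Mega-formalization `lit-balaban`, unit `lit-balaban-r11`
(CMP 119), SKELETON row `B14.Claim@246` (so far "absent: in-proof claim by reference").

THE PRINTED TEXT (p. 246, verbatim): *"… and we assume here that ε₀ is given by the first formula. If a plaquette p′
is contained in (P₀ᶜ)^{(1)}, then Proposition 1 [12] implies that the new field V satisfies the bound
|V(∂p′) − 1| < 2L²ε₀. We introduce stronger restrictions on V by a next decomposition of unity."*  Context: (1.1):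
on `P₀ᶜ` the field `U` has `|U(∂p) − 1| < ε₀`; `V = Ū` is the averaged field (the `δ(ŪV⁻¹)` of (0.1)/(1.6)), the
averaging being that of [12] ((42) p. 23, `B7Prop1Explicit.bavg`); `ε₀ = g₀p₀(g₀)` (first formula), small with `g₀`.

ARITHMETIC OF THE APPLICATION: Proposition 1 of [12] gives `|V̄(∂p′) − 1| < L²α₀ + C₀(L²α₀)²` for `α₀ ≤ c₂′`
whenever `|V(∂p) − 1| < α₀` for `p ⊂ Δ(p′)` (the four blocks at the corners of `p′`).  With `α₀ = ε₀` and `ε₀` so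
small that `C₀L²ε₀ < 1` this is `< 2L²ε₀` — the printed claim; the tree's kernel constants are
`C₀ = 14464(d+1)²(d+4)²`, `c₂′ = 1/(512(d+1)(d+4)L²)` (`prop1_local`), so `L²ε₀ ≤ 1/(2·14464(d+1)²(d+4)²)`
suffices for both.

WHAT IS TYPED (no new carrier; the `ℤ^d` block geometry, contours and average (42) of `B7Prop1Explicit`, the local
plaquette box `Δ(p′)` = `B7Prop1Local.PlaqIn z (deltaHi L z μ ν)`):
* `Claim246Printed d 𝔸` — printed form: there is `c > 0` (the smallness of `ε₀`, "for `g₀` small" p. 246; chosen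
  before everything, F3) such that for every block side `L ≥ 1`, every `ε₀ > 0` with `L²ε₀ ≤ c`, every
  `U1 𝔸`-valued configuration `U` on `ℤ^d` and every plaquette `p′ = (z; μ, ν)` of the `L`-lattice whose box
  `Δ(p′)` has all its unit plaquettes `ε₀`-close to `1` ("p′ ⊂ (P₀ᶜ)^{(1)}"), the averaged field satisfies
  `‖Ū(∂p′) − 1‖ < 2L²ε₀`.  (Model notes: (D1) `U1 𝔸 ⊇ U(N)` = the tree's unit-ball subgroup in a Banach algebra,
  as in all `B7Prop1Explicit` results; (D2) the hypothesis is `≤ ε₀` where the print has `< ε₀` — weaker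
  hypothesis, same conclusion; (D3) explicit `c = 1/(28928(d+1)²(d+4)²)`.)
* `Claim246Printed_holds` — PROVED from `B7Prop1Local.prop1_local`.  Net new unproved facts: 0.
-/

open scoped BigOperators
open NormedSpace Finset

namespace Literature.MathematicalPhysics.QuantumFieldTheory.Balaban1983to89.B14.Claim246

open B7Prop1Explicit B7Prop1Local MatrixLog

-- `Site` alone could resolve to the torus sites of `Setup.lean` through a parent namespace; re-export the `ℤ^d`
-- sites `Fin d → ℤ` of `B7Prop1Explicit`.
export B7Prop1Explicit (Site)

variable {d : ℕ}

/-- **B14 p. 246 (verbatim): *"If a plaquette p′ is contained in (P₀ᶜ)^{(1)}, then Proposition 1 [12] implies that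
the new field V satisfies the bound |V(∂p′) − 1| < 2L²ε₀."*** — printed form over the concrete `ℤ^d` average (42)
of [12] (`bavg`, coarse plaquette `cplaq`), hypothesis (1.1) `|U(∂p) − 1| ≤ ε₀` on the box `Δ(p′)` only.
[cite: Balaban1988Convergent, p.246; (1.1) p.246] -/
def Claim246Printed (d : ℕ) (𝔸 : Type*) [NormedRing 𝔸] [NormOneClass 𝔸] [NormedAlgebra ℂ 𝔸]
    [CompleteSpace 𝔸] : Prop :=
  ∃ c : ℝ, 0 < c ∧ ∀ L : ℕ, 1 ≤ L → ∀ ε₀ : ℝ, 0 < ε₀ → (L : ℝ) ^ 2 * ε₀ ≤ c →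
    ∀ (U : Site d → Fin d → 𝔸ˣ), (∀ x κ, U x κ ∈ U1 𝔸) →
      ∀ (z : Site d) (μ ν : Fin d), μ ≠ ν →
        (∀ (x : Site d) (κ κ' : Fin d), κ ≠ κ' → PlaqIn z (deltaHi L z μ ν) (x, κ, κ') →
          ‖((hol U x (plaqWord κ κ') : 𝔸ˣ) : 𝔸) - 1‖ ≤ ε₀) →
        ‖((cplaq L (bavg L U) z μ ν : 𝔸ˣ) : 𝔸) - 1‖ < 2 * (L : ℝ) ^ 2 * ε₀

/-- **`Claim246Printed` HOLDS**, with `c = 1/(28928(d+1)²(d+4)²)`, by the tree's kernel proof of Proposition 1 of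
[12] with local hypothesis (`B7Prop1Local.prop1_local`: `‖Ū(∂p′) − 1‖ ≤ L²ε₀ + 226(8(d+1)(d+4)L²ε₀)²`) and the
arithmetic `226(8(d+1)(d+4))²(L²ε₀)² ≤ ½L²ε₀ < L²ε₀`. [cite: Balaban1988Convergent, p.246] -/
theorem Claim246Printed_holds (d : ℕ) (𝔸 : Type*) [NormedRing 𝔸] [NormOneClass 𝔸] [NormedAlgebra ℂ 𝔸]
    [CompleteSpace 𝔸] : Claim246Printed d 𝔸 := by
  set K : ℝ := 14464 * ((d : ℝ) + 1) ^ 2 * ((d : ℝ) + 4) ^ 2 with hK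
  have hKpos : 0 < K := by positivity
  refine ⟨1 / (2 * K), by positivity, ?_⟩
  intro L hL ε₀ hε₀ hsmall U hU z μ ν hμν h44
  have h1 : (1 : ℝ) ≤ L := by exact_mod_cast hL
  set t : ℝ := (L : ℝ) ^ 2 * ε₀ with ht
  have htpos : 0 < t := by positivity
  have hKt : K * t ≤ 1 / 2 := by
    have := mul_le_mul_of_nonneg_left hsmall hKpos.le
    rwa [show K * (1 / (2 * K)) = 1 / 2 by field_simp] at this
  -- the smallness hypothesis of `prop1_local`: `512(d+1)(d+4)L²ε₀ ≤ 1`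
  have hsmall' : 512 * (d + 1) * (d + 4) * (L : ℝ) ^ 2 * ε₀ ≤ 1 := by
    have hd0 : (0 : ℝ) ≤ d := Nat.cast_nonneg d
    have hle : (512 : ℝ) * ((d : ℝ) + 1) * ((d : ℝ) + 4) ≤ K := by
      rw [hK]; nlinarith [sq_nonneg ((d : ℝ) + 1), sq_nonneg ((d : ℝ) + 4), mul_nonneg hd0 hd0]
    calc (512 : ℝ) * (d + 1) * (d + 4) * (L : ℝ) ^ 2 * ε₀ = (512 * ((d : ℝ) + 1) * ((d : ℝ) + 4)) * t := by
          rw [ht]; ring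
      _ ≤ K * t := mul_le_mul_of_nonneg_right hle htpos.le
      _ ≤ 1 := by linarith
  have hP := prop1_local L hL z hμν U hU hε₀.le hsmall' h44
  -- `L²ε₀ + 226(8(d+1)(d+4)L²ε₀)² = t + K t² ≤ t + t/2 < 2t`
  have hq : 226 * (8 * ((d : ℝ) + 1) * ((d : ℝ) + 4) * (L : ℝ) ^ 2 * ε₀) ^ 2 = K * t * t := by
    rw [hK, ht]; ring
  have hlt : (L : ℝ) ^ 2 * ε₀ + 226 * (8 * ((d : ℝ) + 1) * ((d : ℝ) + 4) * (L : ℝ) ^ 2 * ε₀) ^ 2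
      < 2 * (L : ℝ) ^ 2 * ε₀ := by
    rw [hq, ← ht]
    have : K * t * t ≤ 1 / 2 * t := mul_le_mul_of_nonneg_right hKt htpos.le
    nlinarith
  exact lt_of_le_of_lt hP hlt

end Literature.MathematicalPhysics.QuantumFieldTheory.Balaban1983to89.B14.Claim246
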